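import Summits.NavierStokesRegularity.FluidComputer.AngularGalerkinLadderBasics
import Summits.NavierStokesRegularity.FluidComputer.AngularGalerkinLadderLinearFlows
import Summits.NavierStokesRegularity.NavierStokesRegularity.Theorems.Target.Negative.EnergyClassLoadBearing

/-!
# Crux `RungBlowupCofinal` (stmt-NavierStokesRegularity-19959), negative side:
# the registered forward-blow-up stub `RungForwardTypeIBlowup L` is junk-inhabited for every `L ≥ 1`

Cell `ns-blowup`, seat `ns-blowup-refuter` (g14), row KJ-18. LABEL: KERNEL typing audit of the
registered BC3 skeleton `Cruxes/RungBlowupCofinal/Lines/birth.lean` (sha16 7291ec516ffe) of the route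
`Theses/AngularGalerkinLadder.lean`. WHAT THIS IS NOT: not Navier–Stokes evidence — no rung blows up
here; the witness is the energy-free parasitic drift flow of Koch–Nadirashvili–Seregin–Šverák
(Acta Math. 203 (2009) §1 p. 3), already used against the summit crux `Target` in
`Theorems/Target/Negative/EnergyClassLoadBearing.lean`.

The skeleton's stub body (written out verbatim below, `ℝ³ = EuclideanSpace ℝ (Fin 3)`) is

  `RungForwardTypeIBlowup L := ∃ T u p d, 0 < T ∧ IsRungSolutionOn (Ico 0 T) 1 L u p d ∧`
  `ContDiff ℝ ⊤ (u 0) ∧ HasRapidSpatialDecay (u 0) ∧ IsTypeIBlowup u T ∧ ¬ ∃ M, ∀ t ∈ Ico 0 T, ∀ x, ‖u t x‖ ≤ M`.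

* `isBandLimited_const` — a CONSTANT field `x ↦ c` is band-limited at every level `L ≥ 1`
  (`𝒞 c = 2c`, so `(𝒞 − 2)𝒞 c = 0`: a constant vector field is the degree-one isotype `j = 1`,
  `ℓ = 0 ⊗ spin 1`).
* `isRungSolutionOn_drift` — hence the drift flow `u(t, x) = −log(1 − t) e₀`, `p = −a'(t) x₀`, with
  ZERO defect force `d = 0`, is a rung-`L` solution on `[0, 1)` for every `L ≥ 1` and every viscosity.
* `rungForwardTypeIBlowup_parasitic` — the stub body holds at every `L ≥ 1` (`T = 1`: datum
  `u 0 = 0` is smooth and rapidly decaying, Type-I constant `2`, `‖u(t, ·)‖ = −log(1 − t) → ∞`);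
  `rungForwardTypeIBlowup_two_parasitic` is the registered BC5 stub `stub_bc5_rung_two_forward_blowup`
  verbatim and `forwardBlowupCofinal_parasitic` is `stub_forward_blowup_cofinal` verbatim — both are
  JUNK-TRUE as typed (missing finite-energy / spatial-decay normalisation on the positive-time slices:
  `IsClassicalNSSolutionOn` carries no energy clause, `IsTypeIBlowup` is a sup-norm rate only, and
  `HasRapidSpatialDecay` binds the datum alone).
* `rungIsSingular_of_dss_extraction_stub` — consequently the skeleton's remaining stub
  `stub_dss_extraction : ∀ L, RungForwardTypeIBlowup L → RungIsSingular L` ALONE already asserts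
  `RungIsSingular L` for EVERY `L ≥ 1` (stronger than the cofinal crux): the two-stub decomposition
  collapses onto one stub that overshoots.

Classification (stub level, not an item verdict): stub-misstated; repairs for the planner are in the
evidence memo KJ-18 on the item (energy class on `[0, T')` for all `T' < T`, or the centred KNSS form
`‖u(t, x)‖ ≤ C / (‖x‖ + √(T − t))` of the Type-I bound). Nothing here closes or refutes the item
(`--supports`). [cite: KochNadirashviliSereginSverak2009, §1 p. 3 (parasitic solutions)]
-/

noncomputable section

open MeasureTheory Set Function Filter
open scoped Topology RealInnerProductSpace ContDiff
open Literature.Analysis.FluidPDE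
open Summit.NavierStokesRegularity.FluidComputer
open Summit.NavierStokesRegularity.FluidComputer.AngularLadder
open Summit.NavierStokesRegularity.NavierStokesRegularity.Theorems.Target.Negative

namespace Summit.NavierStokesRegularity.RungBlowupCofinalForwardStubParasitic

/-! ## §1 Constant fields are band-limited of degree one -/

/-- The rotation generator on a constant field: `J_a c = e_a × c` (the transport term vanishes).
[folklore] -/
theorem angGen_const (a : Fin 3) (c : EuclideanSpace ℝ (Fin 3)) :
    angGen a (fun _ : EuclideanSpace ℝ (Fin 3) => c) = fun _ => cross (axis a) c := by
  funext x
  simp [angGen]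

/-- **The Casimir of a constant field is twice the field**: `𝒞 c = −Σ_a e_a × (e_a × c) = 2c`
(a constant vector field is pure isotype `j = 1`). [folklore] -/
theorem casimir_const (c : EuclideanSpace ℝ (Fin 3)) :
    casimir (fun _ : EuclideanSpace ℝ (Fin 3) => c) = fun _ => (2 : ℝ) • c := by
  funext x
  simp only [casimir, angGen_const]
  apply PiLp.ext
  intro i
  simp only [Fin.sum_univ_three]
  fin_cases i <;>
    simp [cross, cross_apply, axis_apply] <;> ring

/-- `bandDefect 0 c = 𝒞 c = 2c` for a constant field. [folklore] -/
theorem bandDefect_zero_const (c : EuclideanSpace ℝ (Fin 3)) :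
    bandDefect 0 (fun _ : EuclideanSpace ℝ (Fin 3) => c) = fun _ => (2 : ℝ) • c :=
  casimir_const c

/-- `(𝒞 − 2)𝒞 c = 0` for a constant field. [folklore] -/
theorem bandDefect_one_const (c : EuclideanSpace ℝ (Fin 3)) :
    bandDefect 1 (fun _ : EuclideanSpace ℝ (Fin 3) => c) = 0 := by
  funext x
  change casimir (bandDefect 0 (fun _ : EuclideanSpace ℝ (Fin 3) => c)) x -
      ((((0 : ℕ) : ℝ) + 1) * (((0 : ℕ) : ℝ) + 2)) •
        bandDefect 0 (fun _ : EuclideanSpace ℝ (Fin 3) => c) x = 0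
  rw [bandDefect_zero_const, casimir_const]
  simp only [smul_smul, Nat.cast_zero]
  norm_num

/-- **A constant field is band-limited at level one.** [folklore] -/
theorem isBandLimited_one_const (c : EuclideanSpace ℝ (Fin 3)) :
    IsBandLimited 1 (fun _ : EuclideanSpace ℝ (Fin 3) => c) :=
  ⟨contDiff_const, fun x => by rw [bandDefect_one_const]; rfl⟩

/-- **A constant field is band-limited at every level `L ≥ 1`.** [folklore] -/
theorem isBandLimited_const {L : ℕ} (hL : 1 ≤ L) (c : EuclideanSpace ℝ (Fin 3)) :
    IsBandLimited L (fun _ : EuclideanSpace ℝ (Fin 3) => c) :=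
  (isBandLimited_one_const c).mono hL

/-! ## §2 The drift flow is a rung solution with zero defect, at every level `L ≥ 1` -/

/-- **The parasitic drift flow `u = −log(1 − t) e₀`, `p = ⟪−a' e₀, x⟫`, `d = 0` is a rung-`L`
solution on `[0, 1)`** for every `L ≥ 1` and every viscosity: it is a classical solution
(`isClassical_drift`), every velocity slice is constant hence band-limited, and the zero force is
co-band-limited. [cite: KochNadirashviliSereginSverak2009, §1 p. 3 (parasitic solutions)] -/
theorem isRungSolutionOn_drift (ν : ℝ) {L : ℕ} (hL : 1 ≤ L) :
    IsRungSolutionOn (Set.Ico 0 1) ν L driftVel driftPres 0 :=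
  ⟨isClassical_drift ν, fun t _ => isBandLimited_const hL (driftAmp t • e₀),
    fun _ _ => isCobandLimited_zero_field L⟩

/-- The drift flow is unbounded on `[0, 1) × ℝ³`: `‖u(t, x)‖ = −log(1 − t) → ∞` as `t ↑ 1`.
[folklore] -/
theorem not_bounded_driftVel :
    ¬ ∃ M : ℝ, ∀ t ∈ Set.Ico (0 : ℝ) 1, ∀ x, ‖driftVel t x‖ ≤ M := by
  rintro ⟨M, hM⟩
  have h1 : ∀ᶠ t in 𝓝[<] (1 : ℝ), M < driftAmp t :=
    tendsto_driftAmp_atTop.eventually (eventually_gt_atTop M)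
  have h2 : ∀ᶠ t in 𝓝[<] (1 : ℝ), t ∈ Set.Ioo (0 : ℝ) 1 :=
    Ioo_mem_nhdsLT (show (0 : ℝ) < 1 by norm_num)
  obtain ⟨t, ht1, ht2⟩ := (h1.and h2).exists
  have h3 := hM t ⟨ht2.1.le, ht2.2⟩ 0
  have h4 : ‖driftVel t 0‖ = |driftAmp t| := by
    simp [driftVel, norm_smul]
  rw [h4] at h3
  linarith [le_abs_self (driftAmp t)]

/-! ## §3 The registered stub bodies are junk-true -/

/-- **The forward-blow-up stub body `RungForwardTypeIBlowup L` of the registered skeleton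
(`Cruxes/RungBlowupCofinal/Lines/birth.lean`, 7291ec516ffe) holds for every `L ≥ 1`**, witnessed by
the energy-free drift flow (`T = 1`, `ν = 1`, `d = 0`): no blow-up mechanism of any rung is involved.
Stub-misstated: the positive-time slices carry no finite-energy / decay normalisation.
[cite: KochNadirashviliSereginSverak2009, §1 p. 3 (parasitic solutions)] -/
theorem rungForwardTypeIBlowup_parasitic {L : ℕ} (hL : 1 ≤ L) :
    ∃ (T : ℝ) (u : ℝ → EuclideanSpace ℝ (Fin 3) → EuclideanSpace ℝ (Fin 3))
      (p : ℝ → EuclideanSpace ℝ (Fin 3) → ℝ)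
      (d : ℝ → EuclideanSpace ℝ (Fin 3) → EuclideanSpace ℝ (Fin 3)), 0 < T ∧
      AngularLadder.IsRungSolutionOn (Set.Ico 0 T) 1 L u p d ∧
      ContDiff ℝ (⊤ : ℕ∞) (u 0) ∧ Literature.Analysis.FluidPDE.HasRapidSpatialDecay (u 0) ∧
      Literature.Analysis.FluidPDE.IsTypeIBlowup u T ∧
      ¬ ∃ M : ℝ, ∀ t ∈ Set.Ico 0 T, ∀ x, ‖u t x‖ ≤ M :=
  ⟨1, driftVel, driftPres, 0, one_pos, isRungSolutionOn_drift 1 hL,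
    by rw [driftVel_zero]; exact contDiff_const,
    by rw [driftVel_zero]; exact hasRapidSpatialDecay_zero,
    isTypeIBlowup_drift, not_bounded_driftVel⟩

/-- **The registered BC5 stub `stub_bc5_rung_two_forward_blowup : RungForwardTypeIBlowup 2`, verbatim,
is junk-true** (drift flow). [cite: KochNadirashviliSereginSverak2009, §1 p. 3 (parasitic solutions)] -/
theorem rungForwardTypeIBlowup_two_parasitic :
    ∃ (T : ℝ) (u : ℝ → EuclideanSpace ℝ (Fin 3) → EuclideanSpace ℝ (Fin 3))
      (p : ℝ → EuclideanSpace ℝ (Fin 3) → ℝ)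
      (d : ℝ → EuclideanSpace ℝ (Fin 3) → EuclideanSpace ℝ (Fin 3)), 0 < T ∧
      AngularLadder.IsRungSolutionOn (Set.Ico 0 T) 1 2 u p d ∧
      ContDiff ℝ (⊤ : ℕ∞) (u 0) ∧ Literature.Analysis.FluidPDE.HasRapidSpatialDecay (u 0) ∧
      Literature.Analysis.FluidPDE.IsTypeIBlowup u T ∧
      ¬ ∃ M : ℝ, ∀ t ∈ Set.Ico 0 T, ∀ x, ‖u t x‖ ≤ M :=
  rungForwardTypeIBlowup_parasitic (by norm_num)

/-- **The registered stub `stub_forward_blowup_cofinal : ∀ L₀, ∃ L ≥ L₀, RungForwardTypeIBlowup L`,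
verbatim, is junk-true** (take `L = max L₀ 1` and the drift flow).
[cite: KochNadirashviliSereginSverak2009, §1 p. 3 (parasitic solutions)] -/
theorem forwardBlowupCofinal_parasitic :
    ∀ L₀ : ℕ, ∃ L ≥ L₀,
      ∃ (T : ℝ) (u : ℝ → EuclideanSpace ℝ (Fin 3) → EuclideanSpace ℝ (Fin 3))
        (p : ℝ → EuclideanSpace ℝ (Fin 3) → ℝ)
        (d : ℝ → EuclideanSpace ℝ (Fin 3) → EuclideanSpace ℝ (Fin 3)), 0 < T ∧
        AngularLadder.IsRungSolutionOn (Set.Ico 0 T) 1 L u p d ∧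
        ContDiff ℝ (⊤ : ℕ∞) (u 0) ∧ Literature.Analysis.FluidPDE.HasRapidSpatialDecay (u 0) ∧
        Literature.Analysis.FluidPDE.IsTypeIBlowup u T ∧
        ¬ ∃ M : ℝ, ∀ t ∈ Set.Ico 0 T, ∀ x, ‖u t x‖ ≤ M :=
  fun L₀ => ⟨max L₀ 1, le_max_left _ _, rungForwardTypeIBlowup_parasitic (le_max_right _ _)⟩

/-- **Collapse of the two-stub decomposition**: since the forward stub body is inhabited at every
`L ≥ 1`, the skeleton's extraction stub `stub_dss_extraction : ∀ L, RungForwardTypeIBlowup L →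
RungIsSingular L` alone asserts that EVERY rung `L ≥ 1` is singular — a statement stronger than the
(cofinal) crux and false as soon as one rung `≥ 1` is regular. [folklore] -/
theorem rungIsSingular_of_dss_extraction_stub
    (h2 : ∀ L : ℕ,
      (∃ (T : ℝ) (u : ℝ → EuclideanSpace ℝ (Fin 3) → EuclideanSpace ℝ (Fin 3))
        (p : ℝ → EuclideanSpace ℝ (Fin 3) → ℝ)
        (d : ℝ → EuclideanSpace ℝ (Fin 3) → EuclideanSpace ℝ (Fin 3)), 0 < T ∧
        AngularLadder.IsRungSolutionOn (Set.Ico 0 T) 1 L u p d ∧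
        ContDiff ℝ (⊤ : ℕ∞) (u 0) ∧ Literature.Analysis.FluidPDE.HasRapidSpatialDecay (u 0) ∧
        Literature.Analysis.FluidPDE.IsTypeIBlowup u T ∧
        ¬ ∃ M : ℝ, ∀ t ∈ Set.Ico 0 T, ∀ x, ‖u t x‖ ≤ M) →
      AngularLadder.RungIsSingular L) :
    ∀ L : ℕ, 1 ≤ L → AngularLadder.RungIsSingular L :=
  fun _ hL => h2 _ (rungForwardTypeIBlowup_parasitic hL)

end Summit.NavierStokesRegularity.RungBlowupCofinalForwardStubParasitic

end
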